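import Literature.MathematicalPhysics.QuantumLattice.GrassmannKernelExpansion
import Literature.MathematicalPhysics.QuantumLattice.GrassmannRelabelling
import HarnessLib

/-!
# Presented tensors: products of presented polynomials, kernels of a field derivative, and the pinned `L¹` bound of a presentation

Topic `MathematicalPhysics/QuantumLattice`; continuation of `GrassmannKernelsPresented` / `GrassmannKernelExpansion` (`presented R φ = Σ_Y φ(Y) ψ(Y)`,
`kernel_presented`, `eq_sum_presented_kernel`).  The kernel calculus needed to bound the kernels of Salmhofer's bilinear RGE term
`(δa/δψ, C δb/δψ) = Σ_{X,Y} ∂_X a · C(X,Y) · ∂_Y b` (Salmhofer 1998, Prop. 1; the quadratic part of Polchinski's equation, whose kernel estimate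
is Salmhofer 1998 §4.1 / Salmhofer 1999 (4.95)–(4.100)):

* **`presented_mul_presented`** (with the tree's `genProd_append`) — `presented φ · presented χ = presented (φ ⊗ χ)` with
  `(φ ⊗ χ)(Z) = φ(Z ∘ castAdd) χ(Z ∘ natAdd)` (the tensor presentation on `Fin (p + q)`);
* `presented_sum`, `presented_finset_sum` — linearity;
* **`kernel_grassmannDeriv`** — `kernel (∂_u F) p Y = (p + 1) • kernel F (p + 1) (cons u Y)`: differentiating pins a leg (Salmhofer 1999, (4.95));
* **`sum_norm_kernel_presented_le`** — for a FIXED pin value `w`: `Σ_{X : X_i = w} ‖kernel (presented Φ) (m+1) X‖ ≤ max_j Σ_{Z : Z_j = w} ‖Φ Z‖`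
  (the antisymmetrisation costs nothing: each of the `(m+1)!` permutations has a pinned sum bounded by the max over pin POSITIONS at the same value `w`;
  the `w`-local form of `kernelNorm_kernel_presented_le`, needed when the bound depends on the pin, e.g. through a distance weight).

(The product and derivative formulas were first proved route-side in `Summits/…/AposterioriCapRgSeededBrokenRegimeBoseFermiPinned{PolchinskiBilinearBound,KernelCalculus}`
(crux 14047, lead c4); they are generic and are re-proved here so that Literature-level files can use them.)
Everything is proved; no definition, no named fact.

## Sources
M. Salmhofer, Commun. Math. Phys. 194 (1998) 249–295, §3.1 Prop. 1, §3.2 (3.12), §4.1 [`Salmhofer1998`];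
M. Salmhofer, *Renormalization: An Introduction* (Springer 1999), §4.3 (4.95)–(4.100) [`Salmhofer1999`]; F. A. Berezin, *The Method of Second
Quantization* (1966), Ch. I §3 [`Berezin1966`].
-/

noncomputable section

namespace Literature.MathematicalPhysics.QuantumLattice

open GrassmannAlgebra Finset

section Algebra

variable (R : Type*) [CommRing R] {Γ : Type*} [DecidableEq Γ]

variable [Fintype Γ]

/-- Finite sums of presentations. [cite: Salmhofer1998, §3.2 (3.12)] -/
theorem presented_finset_sum {ι : Type*} (s : Finset ι) {k : ℕ} (φ : ι → (Fin k → Γ) → R) :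
    presented R (fun Y => ∑ a ∈ s, φ a Y) = ∑ a ∈ s, presented R (φ a) := by
  classical
  induction s using Finset.induction_on with
  | empty => simp [presented_zero, show (fun _ : Fin k → Γ => (0 : R)) = 0 from rfl]
  | insert a s ha ih =>
    rw [sum_insert ha, ← ih, ← presented_add]
    congr 1
    funext Y
    rw [sum_insert ha]
    rfl

/-- **The product of two presented polynomials is presented by the tensor of the presentations** on `Fin (p + q)`:
`(Σ_Y φ(Y)ψ(Y))(Σ_{Y′} χ(Y′)ψ(Y′)) = Σ_Z φ(Z|_{first p}) χ(Z|_{last q}) ψ(Z)`. [cite: Salmhofer1999, §4.3 (4.95)] -/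
theorem presented_mul_presented {p q : ℕ} (φ : (Fin p → Γ) → R) (χ : (Fin q → Γ) → R) :
    presented R φ * presented R χ =
      presented R (fun Z : Fin (p + q) → Γ => φ (fun i => Z (Fin.castAdd q i)) * χ (fun j => Z (Fin.natAdd p j))) := by
  have lhs : presented R φ * presented R χ = ∑ Y : Fin p → Γ, ∑ Y' : Fin q → Γ, (φ Y * χ Y') • genProd R (Fin.append Y Y') := by
    rw [presented, presented, Finset.sum_mul_sum]
    refine sum_congr rfl fun Y _ => sum_congr rfl fun Y' _ => ?_
    rw [genProd_append, smul_mul_smul_comm]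
  have rhs : presented R (fun Z : Fin (p + q) → Γ => φ (fun i => Z (Fin.castAdd q i)) * χ (fun j => Z (Fin.natAdd p j))) =
      ∑ Y : Fin p → Γ, ∑ Y' : Fin q → Γ, (φ Y * χ Y') • genProd R (Fin.append Y Y') := by
    rw [presented, ← (Fin.appendEquiv p q).sum_comp, Fintype.sum_prod_type]
    refine sum_congr rfl fun Y _ => sum_congr rfl fun Y' _ => ?_
    simp only [Fin.appendEquiv_apply, Fin.append_left, Fin.append_right]
    rfl
  rw [lhs, rhs]

omit [DecidableEq Γ] [Fintype Γ] in
/-- **Differentiating pins a leg**: `kernel (∂_u F) p Y = (p + 1) • kernel F (p + 1) (cons u Y)` (`∂_{Y_{p-1}}⋯∂_{Y_0} ∂_u = ∂_{(u,Y)}`, and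
`((p+1)!)⁻¹·(p+1) = (p!)⁻¹`). [cite: Salmhofer1999, §4.3 (4.95)] -/
theorem kernel_grassmannDeriv [Algebra ℚ R] (u : Γ) (F : GrassmannAlgebra R Γ) (p : ℕ) (Y : Fin p → Γ) :
    kernel R (grassmannDeriv R u F) p Y = ((p + 1 : ℕ) : R) * kernel R F (p + 1) (Fin.cons u Y) := by
  rw [kernel_def, kernel_def, iterDeriv_succ_apply]
  simp only [Fin.cons_zero, Fin.cons_succ]
  have h : ((p.factorial : ℚ)⁻¹ • (1 : R)) = ((p + 1 : ℕ) : R) * (((p + 1).factorial : ℚ)⁻¹ • (1 : R)) := by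
    rw [Nat.factorial_succ, Nat.cast_mul, mul_inv, show ((p + 1 : ℕ) : R) = ((p + 1 : ℕ) : ℚ) • (1 : R) by
      rw [Nat.cast_smul_eq_nsmul, Nat.smul_one_eq_cast], smul_mul_smul_comm, one_mul, ← mul_assoc,
      mul_inv_cancel₀ (by positivity), one_mul]
  rw [h, mul_assoc]

end Algebra

/-! ### The pinned `L¹` bound of a presentation at a fixed pin value -/

section Norms

variable {𝕜 : Type*} [RCLike 𝕜] {Γ : Type*} [Fintype Γ] [DecidableEq Γ]

/-- **For a fixed pin value `w`, the pinned `L¹` sums of the kernel of a presented polynomial are bounded by the largest pinned sum of the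
presentation over the pin POSITIONS**: `Σ_{X : X_i = w} ‖kernel (presented Φ) (m+1) X‖ ≤ M` whenever `Σ_{Z : Z_j = w} ‖Φ Z‖ ≤ M` for every
position `j` (no factorial loss). [cite: Salmhofer1998, §4.1] -/
theorem sum_norm_kernel_presented_le {m : ℕ} (Φ : (Fin (m + 1) → Γ) → 𝕜) (w : Γ) {M : ℝ}
    (hM : ∀ j : Fin (m + 1), ∑ Z ∈ univ.filter (fun Z : Fin (m + 1) → Γ => Z j = w), ‖Φ Z‖ ≤ M) (i : Fin (m + 1)) :
    ∑ X ∈ univ.filter (fun X : Fin (m + 1) → Γ => X i = w), ‖kernel 𝕜 (presented 𝕜 Φ) (m + 1) X‖ ≤ M := by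
  have hfac : ‖(((m + 1).factorial : ℚ)⁻¹ • (1 : 𝕜))‖ = ((m + 1).factorial : ℝ)⁻¹ := by
    rw [Rat.smul_one_eq_cast, Rat.cast_inv, Rat.cast_natCast, norm_inv, RCLike.norm_natCast]
  have hpt : ∀ X : Fin (m + 1) → Γ, ‖kernel 𝕜 (presented 𝕜 Φ) (m + 1) X‖ ≤
      ((m + 1).factorial : ℝ)⁻¹ * ∑ σ : Equiv.Perm (Fin (m + 1)), ‖Φ (X ∘ σ)‖ := by
    intro X
    rw [kernel_presented, norm_mul, hfac]
    refine mul_le_mul_of_nonneg_left ((norm_sum_le _ _).trans (sum_le_sum fun σ _ => le_of_eq ?_)) (by positivity)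
    rw [Units.smul_def, norm_smul]
    rcases Int.units_eq_one_or (Equiv.Perm.sign σ) with h | h <;> simp [h]
  have hM0 : 0 ≤ M := le_trans (sum_nonneg fun _ _ => norm_nonneg _) (hM i)
  calc ∑ X ∈ univ.filter (fun X : Fin (m + 1) → Γ => X i = w), ‖kernel 𝕜 (presented 𝕜 Φ) (m + 1) X‖
      ≤ ∑ X ∈ univ.filter (fun X : Fin (m + 1) → Γ => X i = w),
          (((m + 1).factorial : ℝ)⁻¹ * ∑ σ : Equiv.Perm (Fin (m + 1)), ‖Φ (X ∘ σ)‖) := sum_le_sum fun X _ => hpt X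
    _ = ((m + 1).factorial : ℝ)⁻¹ * ∑ σ : Equiv.Perm (Fin (m + 1)),
          ∑ Z ∈ univ.filter (fun Z : Fin (m + 1) → Γ => Z (σ.symm i) = w), ‖Φ Z‖ := by
        rw [← mul_sum, sum_comm]
        refine congrArg _ (sum_congr rfl fun σ _ => ?_)
        rw [pinnedSum_comp_perm]
    _ ≤ ((m + 1).factorial : ℝ)⁻¹ * ∑ _σ : Equiv.Perm (Fin (m + 1)), M :=
        mul_le_mul_of_nonneg_left (sum_le_sum fun σ _ => hM _) (by positivity)
    _ = M := by
        rw [sum_const, card_univ, Fintype.card_perm, Fintype.card_fin, nsmul_eq_mul, ← mul_assoc,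
          inv_mul_cancel₀ (by positivity), one_mul]

end Norms

end Literature.MathematicalPhysics.QuantumLattice

end
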